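import Mathlib

/-!
# `Balaban1983to89.B7Prop5Induction` — B7 = T. Bałaban, *Averaging operations for lattice gauge
# theories*, Commun. Math. Phys. **98**, 17–51 (1985): the two operator-chain inductions
# (143)ⱼ ⇒ (143)ⱼ₊₁ [(144)–(146), p. 40] and (149)ⱼ ⇒ (149)ⱼ₊₁ [(150)–(151), p. 40; (152)–(155), p. 41]
# of Sect. D, kernel-checked

CITATION HEADER (lean-in-tree rule 2026-08-18).  Bib key `Balaban1985Averaging`; held PDF
`paper:balaban1985-cmp98-averaging` (journal page = PDF page + 16); renders read for this module:
`…/1985-cmp98-averaging-p023-x2.png` (p. 39), `p024-x2` (p. 40), `p025-x2` (p. 41); for v1.1 (unit b07-g3, 2026-08-18,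
DIVERGENCE D-pv14.9: page locators only, every declaration byte-identical) also `p022-x2` (p. 38: (135) is the last
display of Proposition 4, "|C_k(U₀, A)| ≦ C₂|A|² < C₂α₁². (135)") and `p024-x2`/`p025-x2` re-read ((150)–(151) on
p. 40, (152)–(155) on p. 41).  This module is a
SIBLING of `…Balaban1983to89.B7` (typed statements of Props. 1–10; for Prop. 5 the Prop `B7.Prop5Printed`
and the closing numerics `B7.ineq145_bracket`, `B7.ineq155_sample`) and of the sibling in preparation
`…Balaban1983to89.B7Ineq148` (cell unit pv23: the one-step bound (148) from the Cauchy estimate + Schwarz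
lemma — here (148) is a hypothesis).  Nothing landed is edited or restated; imports: Mathlib only.  WHAT IS REPRODUCED: the displayed inequalities (139)–(155) of pp. 39–41 quoted
VERBATIM in the docstrings, and the two INDUCTION STEPS of the printed proof of Proposition 5 re-derived by
the kernel at the level at which the paper argues — inequalities between non-negative bond functions pushed
through positive (= monotone, linear) averaging operators, followed by real arithmetic in `L⁻¹`.  NOTHING
of the series is asserted; the analytic inputs ((139) + Prop. 2, (143)ⱼ, (148), (149)ⱼ, (135), the chain
rule (153)) and the printed operator facts enter as HYPOTHESES (fields of the Prop-valued structures
`OpFacts`, `Hyp154`).  Cell records: pub-balaban GAPS C-B7-D (unit b07: every displayed step of Sect. D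
re-derived by hand, incl. the operator facts "re-derived by counting (exact)"), N-B7-D144 (the coefficient
convention `C′₁ ↔ L²C′₁` from (144) on), G-B7-03/`ineq155_sample` (unit r1), C-pv19-1 (this module).
VALUE = kernel certificate of printed internal implications ("second engine"), NOT summit progress.

## What is printed (verbatim; `|·|` = sup norm resp. pointwise matrix norm, (19)–(20) p. 21)

p. 39: *"From (124) it is clear that we have the inequalities*
`|Q_{V₀}A| ≤ Q|A|, |Q″(V₀)A| ≤ C′₁L²α₀Q″|A|,` (139)
*where the operator `Q` is defined as in [2], and `Q″` is defined as*
`(Q″A)_c = Σ_{b ⊂ B(c₋)∪B(c₊)} L^{-d} A_b.` (140)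
*The constant `C′₁` depends on `d` and `L`.  A composition of `k` operators `Q` is the operator `Q_k`.
The operators `Q″` do not compose in a simple way, but if we introduce an operator `Q″_k` by the formula*
`(Q″_kA)_c = Σ_{b ⊂ B^k(c₋)∪B^k(c₊)} η^d A_b,  c ⊂ Ω^{(k)},` (141)
*then we have the inequality* `|Q″Q″_jA| ≤ Q″Q″_j|A| ≤ 2dQ″_{j+1}|A|.` (142)
*Now we will prove by induction the bound* `|Q_j(U₀)A| ≤ Q_j|A| + 2C′₁α₀(Lʲη)²Q″_j|A|,  j ≤ k,` (143)"

p. 40: *"assuming that `U₀` satisfies the bound (52).  For `j = 1` it is a consequence of (139).  We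
assume (143) for `j < k` and we have*
`|Q_{j+1}(U₀)A| = |Q(Ū₀ʲ)Q_j(U₀)A| ≤ Q|Q_j(U₀)A| + C′₁2α₀(Lʲη)²Q″|Q_j(U₀)A|`
`  ≤ Q(Q_j|A| + 2C′₁α₀(Lʲη)²Q″_j|A|) + C′₁2α₀(Lʲη)² · Q″(Q_j|A| + 2C′₁α₀(Lʲη)²Q″_j|A|)`
`  = Q_{j+1}|A| + 2C′₁α₀(Lʲη)²QQ″_j|A| + 2C′₁α₀(Lʲη)²Q″Q_j|A| + 4C′₁²α₀²(Lʲη)⁴Q″Q″_j|A|` (144)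
*by (139) and Proposition 2.  Further using the inequalities (142), `QQ″_j|A| ≤ 2Q″_{j+1}|A|`, and
`Q″Q_j|A| ≤ Q″_{j+1}|A|`, we get*
`|Q_{j+1}(U₀)A| ≤ Q_{j+1}|A| + 2C′₁α₀(L^{j+1}η)²Q″_{j+1}|A| · (2L⁻² + L⁻² + 4dC′₁α₀L⁻⁴).` (145)
*Because `2L⁻² + L⁻² + 4dC′₁α₀L⁻⁴ ≤ ¾ + 4dC′₁L⁻⁴α₀ ≤ 1` if `16dC′₁L⁻⁴α₀ ≤ 1`, so the bound (143) is
proved for all `j ≤ k`.  For `j = k` we have*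
`|Q_k(U₀)A| ≤ Q_k|A| + 2C′₁α₀Q″_k|A| ≤ (1 + 2C′₁α₀)Q″_k|A|,` (146)
*and this bound implies the required property, namely*
`(δ/δA_b)(Q_k(U₀)A)_c = Q_k(U₀; c, b),  |Q_k(U₀; c, b)| ≤ 1 + 2C′₁α₀.` (147)
*Now we will generalize it to the whole function `Q_k`.  It is enough to prove it for `C_k`.  For
one-step renormalization transformation we have the bound* `|⟨δC(V₀,A)/δA, δA⟩| ≤ C″₁|A|Q″|δA|` (148)
*following easily from general properties of the function `C(V₀,A)`.  The constant `C″₁` depends on `d`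
and `L`.  We will prove that a similar bound holds for the functional derivative of `C_j(U₀,A)` for
arbitrary `j ≤ k`.  We will prove by induction that* `|⟨(δ/δA)C_j(U₀,A), δA⟩| ≤ C₃|A|Q″_j|δA|,` (149)
*where the configurations `A` are considered on `L^{-j}`-lattice and `C₃` is a positive constant
satisfying conditions which will be written later.  From the definition of the functions `Q_j(U₀,ηA)` we
have* `Q_{j+1}(U₀,ηA) = Q(Ū₀ʲ, Q_j(U₀,ηA)),  Q_j(U₀,ηA) = LʲηQ_j(U₀)A + C_j(U₀,LʲηA),` (150) *hence*
`Q_{j+1}(U₀,ηA) = … = L^{j+1}ηQ_{j+1}(U₀)A + C_{j+1}(U₀,L^{j+1}ηA),` (151)"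

p. 41: *"and* `C_{j+1}(U₀,A) = LQ(Ū₀ʲ)C_j(U₀,L⁻¹A) + C(Ū₀ʲ, L⁻¹Q_j(U₀)A + C_j(U₀,L⁻¹A)),` (152)
*`A` is a field configuration considered on `L^{-(j+1)}Z^d`, `|A| < L^{j+1}ηα₁`.  Differentiation of the
above equality gives*
`⟨(δ/δA)C_{j+1}(U₀,A), δA⟩ = Q(Ū₀ʲ)⟨(δC_j/δA)(U₀,L⁻¹A), δA⟩`
`  + ⟨(δC/δA)(Ū₀ʲ, L⁻¹Q_j(U₀)A + C_j(U₀,L⁻¹A)), L⁻¹Q_j(U₀)δA + L⁻¹⟨(δC_j/δA)(U₀,L⁻¹A), δA⟩⟩.` (153)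
*Using (143), (148), (149) we obtain the following bound:*
`|⟨(δ/δA)C_{j+1}(U₀,A), δA⟩| ≤ QC₃L⁻¹|A|Q″_j|δA| + C′₁2α₀(Lʲη)²Q″C₃L⁻¹|A|Q″_j|δA|`
`    + C″₁|L⁻¹Q_j(U₀)A + C_j(U₀,L⁻¹A)| · Q″|L⁻¹Q_j(U₀)δA + L⁻¹⟨(δC_j/δA)(U₀,L⁻¹A), δA⟩|`
`  ≤ C₃(2 − L⁻¹)L⁻¹|A|Q″_{j+1}|δA| + C′₁C₃2α₀2d(Lʲη)²L⁻¹|A|Q″_{j+1}|δA|`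
`    + C″₁L⁻²(Q_j|A| + 2C′₁α₀(Lʲη)²Q″_j|A| + C₂L⁻¹|A|²) · Q″(Q_j|δA| + 2C′₁α₀(Lʲη)²Q″_j|δA| + C₃L⁻¹|A|Q″_j|δA|)`
`  ≤ C₃|A|Q″_{j+1}|δA|[1 − L⁻² + 4dC′₁α₀L⁻³]`
`    + C″₁L⁻²(1 + 4dC′₁α₀L⁻² + C₂L⁻¹α₁) · |A|(1 + 4dC′₁α₀L⁻² + 2dC₃L⁻¹α₁)Q″_{j+1}|δA|`
`  ≤ C₃|A|Q″_{j+1}|δA|[1 − L⁻² + 4dC′₁α₀L⁻³ + (C″₁L⁻²/C₃)(1 + 4dC′₁α₀L⁻² + C₂L⁻¹α₁ + 2dC₃L⁻¹α₁)²].` (154)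
*This bound implies the inequality (149) for `j + 1` if*
`4dC′₁α₀L⁻¹ + (C″₁/C₃)(1 + 4dC′₁α₀L⁻² + C₂L⁻¹α₁ + 2dC₃L⁻¹α₁)² ≤ 1.` (155)
*This inequality is satisfied if `C₃ > C″₁` and `α₀, α₁` are sufficiently small, e.g., we may take
`C₃ = 6C″₁` and `α₀, α₁` satisfying `4dC′₁α₀L⁻¹ ≤ ⅓`, `(C₂L⁻¹ + 12dC″₁L⁻¹)α₁ ≤ ⅔`.  Thus we have proved*
[Proposition 5]".

## Modelling (what the symbols of this file stand for)

After the paper's rescaling ("the configurations `A` are considered on `L^{-j}`-lattice"), one induction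
step `j → j+1` involves three sets of bonds: `B₀` = bonds of the fine lattice carrying `A`, `δA`
(the type of the non-negative functions `nA = |A_·|`, `nδ = |δA_·|`); `B₁` = bonds of the level-`j`
unit lattice, where `Q_j(U₀)A`, `Q_j|A|`, `Q″_j|A|`, `C_j(U₀,·)` and the pairing `⟨δC_j/δA, δA⟩` take
their values; `B₂` = bonds of the level-`j+1` unit lattice (the `L`-lattice of level `j`).  The linear
positive operators are `Qj = Q_j`, `Qj'' = Q″_j : (B₀ → ℝ) →ₗ[ℝ] (B₁ → ℝ)`, the one-step `Q`,
`Q'' = Q″ : (B₁ → ℝ) →ₗ[ℝ] (B₂ → ℝ)` of (139)–(140), and `Qj1 = Q_{j+1}`, `Qj1'' = Q″_{j+1} :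
(B₀ → ℝ) →ₗ[ℝ] (B₂ → ℝ)`; positivity of their kernels is recorded as monotonicity.  The PRINTED
OPERATOR FACTS are the fields of `OpFacts` (hypotheses; the paper states them without proof, unit b07
re-derived them by counting, GAPS C-B7-D): (142); `QQ″_j ≤ κQ″_{j+1}` with `κ = 2` as printed on
p. 40 — while line 2 of (154) uses the SHARPER `κ = 2 − L⁻¹` (true: the one-step kernel `Q(c,·)` is
the tent `L^{-(d+1)}·min(m+1, 2L−1−m)` along the direction of `c`, so a fine bond is met with
multiplicity `≤ 2L − 1`; C-B7-D notes the same), whence the parameter `κ`; `Q″Q_j ≤ Q″_{j+1}`;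
`QQ_j = Q_{j+1}` (p. 39, only `≤` on non-negative functions is used); the normalisations `Q_j1 = 1`,
`Q″_j1 = 2d` behind line 3 of (154) (`Q_j|A| ≤ |A|`, `Q″_j|A| ≤ 2d|A|`).  The analytic objects enter
ONLY through their pointwise norms, as real-valued functions with the printed bounds as hypotheses
(`Hyp154`): `s = (Lʲη)²` with `s ≤ L⁻²` (`j + 1 ≤ k`), `a = |A|` with `a ≤ α₁`
(`|A| < L^{j+1}ηα₁ ≤ α₁`), `qA = |Q_j(U₀)A|`, `qδ = |Q_j(U₀)δA|` with (143)ⱼ, `g = |⟨(δC_j/δA)(U₀,L⁻¹A), δA⟩|`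
with (149)ⱼ at the configuration `L⁻¹A` (`|L⁻¹A| = L⁻¹a`), `cj = |C_j(U₀,L⁻¹A)|` with (135),
`p = |P|` the SUP norm of `P = L⁻¹Q_j(U₀)A + C_j(U₀,L⁻¹A)` (hypothesis `hp`: every uniform bound of the
pointwise norms bounds `p`), `r = |dP|` with `dP = L⁻¹Q_j(U₀)δA + L⁻¹⟨(δC_j/δA)(U₀,L⁻¹A), δA⟩`, and the
two terms `t₁`, `t₂` of the right side of (153) with `T = |⟨(δ/δA)C_{j+1}(U₀,A), δA⟩| ≤ t₁ + t₂`,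
`t₁ ≤ Qg + 2C′₁α₀s·Q″g` ((139) + Prop. 2 for `V₀ = Ū₀ʲ`, exactly as in line 1 of (144)) and
`t₂ ≤ C″₁·p·Q″r` ((148) at `(Ū₀ʲ, P; dP)`; its domain condition `|P| < 2α₁Lʲη ≤ ½c₃` is the paper's,
C-B7-D).  The coefficient `2C′₁α₀(Lʲη)²` is taken as printed (N-B7-D144 explains the `L²`).

## What is kernel-checked

* `ineq144_145` : (143)ⱼ and line 1 of (144) ⇒ (145) with the bracket `κL⁻² + L⁻² + 4dC′₁α₀L⁻⁴`
  (`κ = 2` printed); `ineq145_close` : the bracket is `≤ 1` if `16dC′₁L⁻⁴α₀ ≤ 1`, `L ≥ 2`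
  (same arithmetic as `B7.ineq145_bracket`, here as a polynomial inequality in `L⁻¹`);
  `ineq143_succ` : hence (143)ⱼ₊₁, using `(L^{j+1}η)² = L²s`;  `ineq146` : (146) at `j = k`.
* `ineq154_line2` : (153) + (143), (148), (149)ⱼ, (135) + the operator facts ⇒ line 2 of (154) (with the
  sup norm `|P|` and the factor `Q″(…)` already estimated as in line 3 — the paper does both in one
  breath); `ineq154_arith` : line 2 ⇒ line 3 ⇒ line 4 (`κ = 2 − L⁻¹`; needs exactly `L ≥ 2`,
  `s ≤ L⁻²`, `a ≤ α₁`, `C₃ > 0`); `ineq154` : the printed (154); `ineq149_succ` : (154) + (155) ⇒ (149)ⱼ₊₁;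
  `ineq155_of_sample` : the sample constants of p. 41 imply (155) (`= B7.ineq155_sample` in substance:
  `⅓ + (1/6)(11/6)² = 193/216`).
* Remark `kappa_two_no_room` : with the cruder `κ = 2` of p. 40 the first term of line 3 is
  `C₃·2L⁻¹·|A|Q″_{j+1}|δA|`, which at `L = 2` already exhausts the budget `1` of (155) — the sharper
  `κ = 2 − L⁻¹` the paper silently uses in (154) is what makes `L = 2` admissible (any `L ≥ 3` works
  with `κ = 2` and a modified (155)); recorded, not an objection (the sharper fact is true, C-B7-D).
* `opFacts_nonvacuous`, `hyp154_nonvacuous` : the hypothesis structures are satisfiable (identity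
  operators on one bond, resp. the zero data), so none of the implications is vacuous.
-/

namespace Literature.MathematicalPhysics.QuantumFieldTheory.Balaban1983to89.B7Prop5Induction

variable {B₀ B₁ B₂ : Type*}

/-! ## 1. Positive averaging operators: the printed operator facts as hypotheses -/

/-- The printed operator facts of pp. 39–40 for one induction step `j → j+1`, on NON-NEGATIVE bond
functions (`Qj = Q_j`, `Qj'' = Q″_j`, `Q`, `Q'' = Q″`, `Qj1 = Q_{j+1}`, `Qj1'' = Q″_{j+1}`; see the module
docstring).  `κ` is the constant of `QQ″_j|A| ≤ κQ″_{j+1}|A|`: printed `2` (p. 40, after (144)); line 2 of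
(154) uses `2 − L⁻¹`.  All fields are hypotheses — finite block-geometry facts the paper states without
proof (re-derived by counting in the cell census C-B7-D), not proved here.
[cite: Balaban1985Averaging, (139)–(142) p.39, p.40 l.9] -/
structure OpFacts (d κ : ℝ) (Qj Qj'' : (B₀ → ℝ) →ₗ[ℝ] (B₁ → ℝ)) (Q Q'' : (B₁ → ℝ) →ₗ[ℝ] (B₂ → ℝ))
    (Qj1 Qj1'' : (B₀ → ℝ) →ₗ[ℝ] (B₂ → ℝ)) : Prop where
  monoQj : Monotone Qj
  monoQj'' : Monotone Qj''
  monoQ : Monotone Q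
  monoQ'' : Monotone Q''
  monoQj1 : Monotone Qj1
  monoQj1'' : Monotone Qj1''
  /-- p. 39: "A composition of `k` operators `Q` is the operator `Q_k`" — used in (144) as
  `Q(Q_j|A|) = Q_{j+1}|A|`; only `≤` on non-negative functions is needed. -/
  qq : ∀ f : B₀ → ℝ, 0 ≤ f → Q (Qj f) ≤ Qj1 f
  /-- p. 40: `QQ″_j|A| ≤ 2Q″_{j+1}|A|` (`κ = 2`), resp. the sharper `κ = 2 − L⁻¹` used in (154). -/
  qq'' : ∀ f : B₀ → ℝ, 0 ≤ f → Q (Qj'' f) ≤ κ • Qj1'' f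
  /-- p. 40: `Q″Q_j|A| ≤ Q″_{j+1}|A|`. -/
  q''q : ∀ f : B₀ → ℝ, 0 ≤ f → Q'' (Qj f) ≤ Qj1'' f
  /-- (142): `Q″Q″_j|A| ≤ 2dQ″_{j+1}|A|`. -/
  q''q'' : ∀ f : B₀ → ℝ, 0 ≤ f → Q'' (Qj'' f) ≤ (2 * d) • Qj1'' f
  /-- `Q_j1 = 1` (an average): `Q_j|A| ≤ |A|`, used in line 3 of (154). -/
  qj_le_sup : ∀ (f : B₀ → ℝ) (M : ℝ), 0 ≤ M → (∀ b, f b ≤ M) → ∀ c, Qj f c ≤ M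
  /-- `Q″_j1 = 2d` by (141): `Q″_j|A| ≤ 2d|A|`, used in line 3 of (154). -/
  qj''_le_sup : ∀ (f : B₀ → ℝ) (M : ℝ), 0 ≤ M → (∀ b, f b ≤ M) → ∀ c, Qj'' f c ≤ 2 * d * M

section helpers

variable {ι ι' : Type*}

/-- A monotone linear operator maps non-negative functions to non-negative functions. [folklore] -/
theorem apply_nonneg (T : (ι → ℝ) →ₗ[ℝ] (ι' → ℝ)) (hT : Monotone T) {f : ι → ℝ} (hf : 0 ≤ f)
    (c : ι') : 0 ≤ T f c := by
  have h := hT hf c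
  simpa using h

/-- Pushing `f ≤ a • u` through a monotone linear operator, pointwise. [folklore] -/
theorem apply_le_of_le_smul (T : (ι → ℝ) →ₗ[ℝ] (ι' → ℝ)) (hT : Monotone T) {f u : ι → ℝ}
    {a : ℝ} (h : f ≤ a • u) (c : ι') : T f c ≤ a * T u c := by
  have h' := hT h c
  simpa [map_smul, Pi.smul_apply, smul_eq_mul] using h'

/-- Pushing `f ≤ u + a • v` through a monotone linear operator, pointwise. [folklore] -/
theorem apply_le_of_le_add_smul (T : (ι → ℝ) →ₗ[ℝ] (ι' → ℝ)) (hT : Monotone T) {f u v : ι → ℝ}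
    {a : ℝ} (h : f ≤ u + a • v) (c : ι') : T f c ≤ T u c + a * T v c := by
  have h' := hT h c
  simpa [map_add, map_smul, Pi.add_apply, Pi.smul_apply, smul_eq_mul] using h'

end helpers

/-! ## 2. The induction (143)ⱼ ⇒ (143)ⱼ₊₁: displays (144)–(146) -/

/-- **(144)–(145)** (p. 40 [PDF 24]).  From (143)ⱼ for `A` (`h143 : |Q_j(U₀)A| ≤ Q_j|A| + 2C′₁α₀s·Q″_j|A|`,
`s = (Lʲη)²`) and line 1 of (144) (`h139 : |Q_{j+1}(U₀)A| = |Q(Ū₀ʲ)Q_j(U₀)A| ≤ Q|Q_j(U₀)A| +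
C′₁2α₀s·Q″|Q_j(U₀)A|`, i.e. (139) + Prop. 2), the operator facts give (145) with the bracket
`κL⁻² + L⁻² + 4dC′₁α₀L⁻⁴` (`κ = 2` printed), where `(L^{j+1}η)² = L²s` and `(Lʲη)² ≤ L⁻²` was used inside
the bracket exactly as printed. [cite: Balaban1985Averaging, (143)–(145) p.40] -/
theorem ineq144_145 {L d κ C₁' α₀ s : ℝ} {Qj Qj'' : (B₀ → ℝ) →ₗ[ℝ] (B₁ → ℝ)}
    {Q Q'' : (B₁ → ℝ) →ₗ[ℝ] (B₂ → ℝ)} {Qj1 Qj1'' : (B₀ → ℝ) →ₗ[ℝ] (B₂ → ℝ)}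
    (hop : OpFacts d κ Qj Qj'' Q Q'' Qj1 Qj1'') (hL : 0 < L) (hd : 0 ≤ d) (hC₁' : 0 ≤ C₁')
    (hα₀ : 0 ≤ α₀) (hs : 0 ≤ s) (hsL : s ≤ L⁻¹ ^ 2)
    {nA : B₀ → ℝ} (hnA : 0 ≤ nA) {qA : B₁ → ℝ} {qA1 : B₂ → ℝ}
    (h143 : qA ≤ Qj nA + (2 * C₁' * α₀ * s) • Qj'' nA)
    (h139 : qA1 ≤ Q qA + (2 * C₁' * α₀ * s) • Q'' qA) (c : B₂) :
    qA1 c ≤ Qj1 nA c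
      + 2 * C₁' * α₀ * (L ^ 2 * s) * Qj1'' nA c * (κ * L⁻¹ ^ 2 + L⁻¹ ^ 2 + 4 * d * C₁' * α₀ * L⁻¹ ^ 4) := by
  set ε := 2 * C₁' * α₀ * s with hε_def
  have hε : 0 ≤ ε := by rw [hε_def]; positivity
  set V := Qj1'' nA c with hV_def
  have hV : 0 ≤ V := apply_nonneg Qj1'' hop.monoQj1'' hnA c
  -- line 1 of (144), pointwise
  have h1 : qA1 c ≤ Q qA c + ε * Q'' qA c := by
    simpa [Pi.add_apply, Pi.smul_apply, smul_eq_mul] using h139 c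
  -- `Q` and `Q″` pushed through (143)ⱼ (line 2 of (144)) and the operator facts (line 3, (145))
  have hQ : Q qA c ≤ Qj1 nA c + ε * (κ * V) := by
    have e := apply_le_of_le_add_smul Q hop.monoQ h143 c
    have f1 : Q (Qj nA) c ≤ Qj1 nA c := hop.qq nA hnA c
    have f2 : Q (Qj'' nA) c ≤ κ * V := by
      simpa [Pi.smul_apply, smul_eq_mul, hV_def] using hop.qq'' nA hnA c
    calc Q qA c ≤ Q (Qj nA) c + ε * Q (Qj'' nA) c := e
      _ ≤ Qj1 nA c + ε * (κ * V) := add_le_add f1 (mul_le_mul_of_nonneg_left f2 hε)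
  have hQ'' : Q'' qA c ≤ V + ε * (2 * d * V) := by
    have e := apply_le_of_le_add_smul Q'' hop.monoQ'' h143 c
    have f1 : Q'' (Qj nA) c ≤ V := by simpa [hV_def] using hop.q''q nA hnA c
    have f2 : Q'' (Qj'' nA) c ≤ 2 * d * V := by
      simpa [Pi.smul_apply, smul_eq_mul, hV_def] using hop.q''q'' nA hnA c
    calc Q'' qA c ≤ Q'' (Qj nA) c + ε * Q'' (Qj'' nA) c := e
      _ ≤ V + ε * (2 * d * V) := add_le_add f1 (mul_le_mul_of_nonneg_left f2 hε)
  -- (144): qA1 c ≤ Q_{j+1}|A| + ε(κ + 1 + 2dε)·V; then (Lʲη)² ≤ L⁻² inside the bracket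
  have h144 : qA1 c ≤ Qj1 nA c + ε * (κ + 1 + 2 * d * ε) * V := by
    calc qA1 c ≤ Q qA c + ε * Q'' qA c := h1
      _ ≤ (Qj1 nA c + ε * (κ * V)) + ε * (V + ε * (2 * d * V)) :=
          add_le_add hQ (mul_le_mul_of_nonneg_left hQ'' hε)
      _ = Qj1 nA c + ε * (κ + 1 + 2 * d * ε) * V := by ring
  have hLl : L * L⁻¹ = 1 := mul_inv_cancel₀ hL.ne'
  have hεL : ε ≤ 2 * C₁' * α₀ * L⁻¹ ^ 2 := by
    rw [hε_def]; exact mul_le_mul_of_nonneg_left hsL (by positivity)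
  have key : ε * (κ + 1 + 2 * d * ε) * V
      ≤ 2 * C₁' * α₀ * (L ^ 2 * s) * V * (κ * L⁻¹ ^ 2 + L⁻¹ ^ 2 + 4 * d * C₁' * α₀ * L⁻¹ ^ 4) := by
    have expand : 2 * C₁' * α₀ * (L ^ 2 * s) * V * (κ * L⁻¹ ^ 2 + L⁻¹ ^ 2 + 4 * d * C₁' * α₀ * L⁻¹ ^ 4)
        = ε * (κ + 1 + 2 * d * (2 * C₁' * α₀ * L⁻¹ ^ 2)) * V * (L * L⁻¹) ^ 2 := by
      rw [hε_def]; ring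
    rw [expand, hLl, one_pow, mul_one]
    have hεV : 0 ≤ ε * V := mul_nonneg hε hV
    have inner : κ + 1 + 2 * d * ε ≤ κ + 1 + 2 * d * (2 * C₁' * α₀ * L⁻¹ ^ 2) := by
      have := mul_le_mul_of_nonneg_left hεL (by positivity : (0:ℝ) ≤ 2 * d)
      linarith
    calc ε * (κ + 1 + 2 * d * ε) * V = (ε * V) * (κ + 1 + 2 * d * ε) := by ring
      _ ≤ (ε * V) * (κ + 1 + 2 * d * (2 * C₁' * α₀ * L⁻¹ ^ 2)) :=
          mul_le_mul_of_nonneg_left inner hεV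
      _ = ε * (κ + 1 + 2 * d * (2 * C₁' * α₀ * L⁻¹ ^ 2)) * V := by ring
  linarith [h144, key]

/-- **(145), closing arithmetic** (p. 40: *"Because `2L⁻² + L⁻² + 4dC′₁α₀L⁻⁴ ≤ ¾ + 4dC′₁L⁻⁴α₀ ≤ 1` if
`16dC′₁L⁻⁴α₀ ≤ 1`"*), for `L ≥ 2`; the same arithmetic as `B7.ineq145_bracket`, written as a polynomial
inequality in `L⁻¹`. [cite: Balaban1985Averaging, (145) p.40] -/
theorem ineq145_close {L d C₁' α₀ : ℝ} (hL : 2 ≤ L) (h : 16 * d * C₁' * L⁻¹ ^ 4 * α₀ ≤ 1) :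
    2 * L⁻¹ ^ 2 + L⁻¹ ^ 2 + 4 * d * C₁' * α₀ * L⁻¹ ^ 4 ≤ 1 := by
  have hLpos : 0 < L := by linarith
  have hl0 : 0 ≤ L⁻¹ := inv_nonneg.mpr hLpos.le
  have hl : L⁻¹ ≤ 1 / 2 := by
    rw [inv_eq_one_div, div_le_div_iff₀ hLpos (by norm_num)]; linarith
  have hl2 : L⁻¹ ^ 2 ≤ 1 / 4 := by nlinarith
  nlinarith

/-- **(143)ⱼ₊₁ from (145)**: with the closing arithmetic, `|Q_{j+1}(U₀)A| ≤ Q_{j+1}|A| +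
2C′₁α₀(L^{j+1}η)²Q″_{j+1}|A|`, `(L^{j+1}η)² = L²s` (printed `κ = 2`). [cite: Balaban1985Averaging, (143)–(145) p.40] -/
theorem ineq143_succ {L d C₁' α₀ s : ℝ} {Qj Qj'' : (B₀ → ℝ) →ₗ[ℝ] (B₁ → ℝ)}
    {Q Q'' : (B₁ → ℝ) →ₗ[ℝ] (B₂ → ℝ)} {Qj1 Qj1'' : (B₀ → ℝ) →ₗ[ℝ] (B₂ → ℝ)}
    (hop : OpFacts d 2 Qj Qj'' Q Q'' Qj1 Qj1'') (hL : 2 ≤ L) (hd : 0 ≤ d) (hC₁' : 0 ≤ C₁')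
    (hα₀ : 0 ≤ α₀) (hs : 0 ≤ s) (hsL : s ≤ L⁻¹ ^ 2) (h145 : 16 * d * C₁' * L⁻¹ ^ 4 * α₀ ≤ 1)
    {nA : B₀ → ℝ} (hnA : 0 ≤ nA) {qA : B₁ → ℝ} {qA1 : B₂ → ℝ}
    (h143 : qA ≤ Qj nA + (2 * C₁' * α₀ * s) • Qj'' nA)
    (h139 : qA1 ≤ Q qA + (2 * C₁' * α₀ * s) • Q'' qA) :
    qA1 ≤ Qj1 nA + (2 * C₁' * α₀ * (L ^ 2 * s)) • Qj1'' nA := by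
  intro c
  have hLpos : 0 < L := by linarith
  have h1 := ineq144_145 hop hLpos hd hC₁' hα₀ hs hsL hnA h143 h139 c
  have hbr := ineq145_close hL h145
  have hV : 0 ≤ Qj1'' nA c := apply_nonneg Qj1'' hop.monoQj1'' hnA c
  have hcoef : 0 ≤ 2 * C₁' * α₀ * (L ^ 2 * s) * Qj1'' nA c := by positivity
  have h2 : 2 * C₁' * α₀ * (L ^ 2 * s) * Qj1'' nA c
      * (2 * L⁻¹ ^ 2 + L⁻¹ ^ 2 + 4 * d * C₁' * α₀ * L⁻¹ ^ 4)
      ≤ 2 * C₁' * α₀ * (L ^ 2 * s) * Qj1'' nA c := by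
    simpa using mul_le_mul_of_nonneg_left hbr hcoef
  simp only [Pi.add_apply, Pi.smul_apply, smul_eq_mul]
  linarith [h1, h2]

/-- **(146)** (p. 40, `j = k`, `Lᵏη = 1`): from (143)ₖ and `Q_k|A| ≤ Q″_k|A|` (the straight-line kernel
of `Q_k` puts weight `≤ η^d` on each fine bond of `B^k(c₋) ∪ B^k(c₊)`, C-B7-D),
`|Q_k(U₀)A| ≤ (1 + 2C′₁α₀)Q″_k|A|` — whence (147) `|Q_k(U₀; c, b)| ≤ 1 + 2C′₁α₀` entry-wise.
[cite: Balaban1985Averaging, (146)–(147) p.40] -/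
theorem ineq146 {C₁' α₀ : ℝ} {Qk Qk'' : (B₀ → ℝ) →ₗ[ℝ] (B₁ → ℝ)}
    (hQk : ∀ f : B₀ → ℝ, 0 ≤ f → Qk f ≤ Qk'' f) {nA : B₀ → ℝ} (hnA : 0 ≤ nA) {qA : B₁ → ℝ}
    (h143k : qA ≤ Qk nA + (2 * C₁' * α₀) • Qk'' nA) :
    qA ≤ (1 + 2 * C₁' * α₀) • Qk'' nA := by
  intro c
  have h1 : qA c ≤ Qk nA c + 2 * C₁' * α₀ * Qk'' nA c := by
    simpa [Pi.add_apply, Pi.smul_apply, smul_eq_mul] using h143k c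
  have h2 : Qk nA c ≤ Qk'' nA c := hQk nA hnA c
  simp only [Pi.smul_apply, smul_eq_mul]
  linarith

/-! ## 3. The induction (149)ⱼ ⇒ (149)ⱼ₊₁: displays (152)–(155) -/

/-- The data of ONE step `j → j+1` of the induction (149), through their pointwise norms, with the printed
bounds as hypotheses (see the module docstring, § Modelling, for the dictionary).  Constants: `L ≥ 2`, `d`,
`C′₁ = C₁'`, `C″₁ = C₁''`, `C₂` (Prop. 4), `C₃`, `α₀`, `α₁`; `s = (Lʲη)²`, `a = |A|`, `p = |P|`.
[cite: Balaban1985Averaging, (135) p.38, (143) p.39, (148)–(149) p.40, (152)–(153) p.41] -/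
structure Hyp154 (L d C₁' C₁'' C₂ C₃ α₀ α₁ s a p : ℝ) (nA nδ : B₀ → ℝ) (qA qδ g cj r : B₁ → ℝ)
    (t₁ t₂ T : B₂ → ℝ) (Qj Qj'' : (B₀ → ℝ) →ₗ[ℝ] (B₁ → ℝ)) (Q Q'' : (B₁ → ℝ) →ₗ[ℝ] (B₂ → ℝ)) :
    Prop where
  hL : 2 ≤ L
  hd : 0 ≤ d
  hC₁' : 0 ≤ C₁'
  hC₁'' : 0 ≤ C₁''
  hC₂ : 0 ≤ C₂
  hC₃ : 0 ≤ C₃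
  hα₀ : 0 ≤ α₀
  /-- `s = (Lʲη)² ≥ 0` -/
  hs : 0 ≤ s
  /-- `(Lʲη)² ≤ L⁻²` since `j + 1 ≤ k`, `Lᵏη = 1` -/
  hsL : s ≤ L⁻¹ ^ 2
  /-- `a = |A| ≥ 0` -/
  ha : 0 ≤ a
  /-- p. 41: `|A| < L^{j+1}ηα₁ ≤ α₁` -/
  haα : a ≤ α₁
  nA_nonneg : 0 ≤ nA
  /-- `|A_b| ≤ |A|` (sup norm) -/
  nA_le : ∀ b, nA b ≤ a
  nδ_nonneg : 0 ≤ nδ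
  r_nonneg : 0 ≤ r
  /-- (143)ⱼ for `A`: `|Q_j(U₀)A| ≤ Q_j|A| + 2C′₁α₀(Lʲη)²Q″_j|A|` -/
  h143A : qA ≤ Qj nA + (2 * C₁' * α₀ * s) • Qj'' nA
  /-- (143)ⱼ for `δA` -/
  h143δ : qδ ≤ Qj nδ + (2 * C₁' * α₀ * s) • Qj'' nδ
  /-- (149)ⱼ at the configuration `L⁻¹A`: `|⟨(δC_j/δA)(U₀,L⁻¹A), δA⟩| ≤ C₃|L⁻¹A|Q″_j|δA|` -/
  h149 : g ≤ (C₃ * (L⁻¹ * a)) • Qj'' nδ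
  /-- (135) at `L⁻¹A`: `|C_j(U₀,L⁻¹A)| ≤ C₂|L⁻¹A|²` (C-B7-D reads the level-`j` version with an extra
  factor `L^{-j} ≤ 1`; either gives this) -/
  h135 : ∀ c', cj c' ≤ C₂ * (L⁻¹ * a) ^ 2
  /-- `p = |P|` is the sup norm of `P = L⁻¹Q_j(U₀)A + C_j(U₀,L⁻¹A)`: a uniform bound of the pointwise
  norms `≤ L⁻¹|Q_j(U₀)A|(c′) + |C_j(U₀,L⁻¹A)|(c′)` bounds `p` -/
  hp : ∀ K, 0 ≤ K → (∀ c', L⁻¹ * qA c' + cj c' ≤ K) → p ≤ K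
  /-- `|dP| ≤ L⁻¹|Q_j(U₀)δA| + L⁻¹|⟨(δC_j/δA)(U₀,L⁻¹A), δA⟩|` pointwise, `dP` the second argument of the
  last pairing in (153) -/
  hr : r ≤ L⁻¹ • qδ + L⁻¹ • g
  /-- first term of (153): `|Q(Ū₀ʲ)G| ≤ Q|G| + C′₁2α₀(Lʲη)²Q″|G|` by (139) and Prop. 2 (as in (144)) -/
  ht₁ : t₁ ≤ Q g + (2 * C₁' * α₀ * s) • Q'' g
  /-- second term of (153) by (148) at `(Ū₀ʲ, P; dP)`: `≤ C″₁|P|Q″|dP|` -/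
  ht₂ : t₂ ≤ (C₁'' * p) • Q'' r
  /-- (153) and the triangle inequality: `T = |⟨(δ/δA)C_{j+1}(U₀,A), δA⟩| ≤ t₁ + t₂` -/
  hT : T ≤ t₁ + t₂

/-- **(154), lines 1–2** (p. 41 [PDF 25]).  (153) with (143), (148), (149)ⱼ, (135) and the operator facts
(`QQ″_j ≤ κQ″_{j+1}`, (142), `Q″Q_j ≤ Q″_{j+1}`, `Q_j|A| ≤ |A|`, `Q″_j|A| ≤ 2d|A|`) gives, at every
bond `c` of the level-`j+1` lattice, line 2 of (154) — with the sup norm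
`|L⁻¹Q_j(U₀)A + C_j(U₀,L⁻¹A)| ≤ L⁻¹(|A| + 2C′₁α₀(Lʲη)²·2d|A|) + C₂L⁻²|A|²` and the last factor
`Q″(Q_j|δA| + 2C′₁α₀(Lʲη)²Q″_j|δA| + C₃L⁻¹|A|Q″_j|δA|) ≤ L⁻¹(1 + 2C′₁α₀(Lʲη)²·2d + C₃L⁻¹|A|·2d)Q″_{j+1}|δA|`
already estimated (the print does this between lines 2 and 3). [cite: Balaban1985Averaging, (153)–(154) p.41] -/
theorem ineq154_line2 {L d κ C₁' C₁'' C₂ C₃ α₀ α₁ s a p : ℝ} {nA nδ : B₀ → ℝ}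
    {qA qδ g cj r : B₁ → ℝ} {t₁ t₂ T : B₂ → ℝ} {Qj Qj'' : (B₀ → ℝ) →ₗ[ℝ] (B₁ → ℝ)}
    {Q Q'' : (B₁ → ℝ) →ₗ[ℝ] (B₂ → ℝ)} {Qj1 Qj1'' : (B₀ → ℝ) →ₗ[ℝ] (B₂ → ℝ)}
    (hop : OpFacts d κ Qj Qj'' Q Q'' Qj1 Qj1'')
    (h : Hyp154 L d C₁' C₁'' C₂ C₃ α₀ α₁ s a p nA nδ qA qδ g cj r t₁ t₂ T Qj Qj'' Q Q'') (c : B₂) :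
    T c ≤ C₃ * κ * L⁻¹ * a * Qj1'' nδ c
        + C₁' * C₃ * 2 * α₀ * (2 * d) * s * L⁻¹ * a * Qj1'' nδ c
        + C₁'' * (L⁻¹ * (a + 2 * C₁' * α₀ * s * (2 * d) * a) + C₂ * (L⁻¹ * a) ^ 2)
            * (L⁻¹ * (1 + 2 * C₁' * α₀ * s * (2 * d) + C₃ * (L⁻¹ * a) * (2 * d)) * Qj1'' nδ c) := by
  obtain ⟨hL, hd, hC₁', hC₁'', hC₂, hC₃, hα₀, hs, hsL, ha, haα, nA_nn, nA_le, nδ_nn, r_nn,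
    h143A, h143δ, h149, h135, hp, hr, ht₁, ht₂, hT⟩ := h
  have hLpos : 0 < L := by linarith
  have hl : 0 ≤ L⁻¹ := inv_nonneg.mpr hLpos.le
  set ε := 2 * C₁' * α₀ * s with hε_def
  have hε : 0 ≤ ε := by rw [hε_def]; positivity
  set W := Qj1'' nδ c with hW_def
  have hW : 0 ≤ W := apply_nonneg Qj1'' hop.monoQj1'' nδ_nn c
  -- first term of line 1 → line 2: `Q` through (149)ⱼ, then `QQ″_j ≤ κQ″_{j+1}`
  have hS1 : Q g c ≤ C₃ * (L⁻¹ * a) * (κ * W) := by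
    have h1 : Q g c ≤ C₃ * (L⁻¹ * a) * Q (Qj'' nδ) c := apply_le_of_le_smul Q hop.monoQ h149 c
    have h2 : Q (Qj'' nδ) c ≤ κ * W := by
      simpa [Pi.smul_apply, smul_eq_mul, hW_def] using hop.qq'' nδ nδ_nn c
    exact h1.trans (mul_le_mul_of_nonneg_left h2 (by positivity))
  -- second term: `Q″` through (149)ⱼ, then (142)
  have hS2 : Q'' g c ≤ C₃ * (L⁻¹ * a) * (2 * d * W) := by
    have h1 : Q'' g c ≤ C₃ * (L⁻¹ * a) * Q'' (Qj'' nδ) c := apply_le_of_le_smul Q'' hop.monoQ'' h149 c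
    have h2 : Q'' (Qj'' nδ) c ≤ 2 * d * W := by
      simpa [Pi.smul_apply, smul_eq_mul, hW_def] using hop.q''q'' nδ nδ_nn c
    exact h1.trans (mul_le_mul_of_nonneg_left h2 (by positivity))
  -- third term, first factor: the sup norm `|P|` via (143)ⱼ, `Q_j1 = 1`, `Q″_j1 = 2d`, (135)
  set K := L⁻¹ * (a + ε * (2 * d) * a) + C₂ * (L⁻¹ * a) ^ 2 with hK_def
  have hK0 : 0 ≤ K := by rw [hK_def]; positivity
  have hK : p ≤ K := by
    refine hp K hK0 ?_
    intro c'
    have hq : qA c' ≤ a + ε * (2 * d * a) := by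
      have h1 : qA c' ≤ Qj nA c' + ε * Qj'' nA c' := by
        simpa [Pi.add_apply, Pi.smul_apply, smul_eq_mul] using h143A c'
      have h2 : Qj nA c' ≤ a := hop.qj_le_sup nA a ha nA_le c'
      have h3 : Qj'' nA c' ≤ 2 * d * a := hop.qj''_le_sup nA a ha nA_le c'
      exact h1.trans (add_le_add h2 (mul_le_mul_of_nonneg_left h3 hε))
    calc L⁻¹ * qA c' + cj c' ≤ L⁻¹ * (a + ε * (2 * d * a)) + C₂ * (L⁻¹ * a) ^ 2 :=
          add_le_add (mul_le_mul_of_nonneg_left hq hl) (h135 c')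
      _ = K := by rw [hK_def]; ring
  -- third term, second factor: `Q″|dP|` via (143)ⱼ for δA, (149)ⱼ, then `Q″Q_j ≤ Q″_{j+1}`, (142)
  have hS4 : Q'' r c ≤ L⁻¹ * (W + ε * (2 * d * W)) + L⁻¹ * (C₃ * (L⁻¹ * a)) * (2 * d * W) := by
    have hr' : r ≤ L⁻¹ • (Qj nδ + ε • Qj'' nδ) + (L⁻¹ * (C₃ * (L⁻¹ * a))) • Qj'' nδ := by
      have h1 : L⁻¹ • qδ ≤ L⁻¹ • (Qj nδ + ε • Qj'' nδ) := smul_le_smul_of_nonneg_left h143δ hl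
      have h2 : L⁻¹ • g ≤ (L⁻¹ * (C₃ * (L⁻¹ * a))) • Qj'' nδ := by
        have := smul_le_smul_of_nonneg_left h149 hl
        simpa [smul_smul] using this
      exact hr.trans (add_le_add h1 h2)
    have hmono := hop.monoQ'' hr' c
    have e1 : Q'' (Qj nδ) c ≤ W := by simpa [hW_def] using hop.q''q nδ nδ_nn c
    have e2 : Q'' (Qj'' nδ) c ≤ 2 * d * W := by
      simpa [Pi.smul_apply, smul_eq_mul, hW_def] using hop.q''q'' nδ nδ_nn c
    have expand : Q'' (L⁻¹ • (Qj nδ + ε • Qj'' nδ) + (L⁻¹ * (C₃ * (L⁻¹ * a))) • Qj'' nδ) c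
        = L⁻¹ * (Q'' (Qj nδ) c + ε * Q'' (Qj'' nδ) c)
          + L⁻¹ * (C₃ * (L⁻¹ * a)) * Q'' (Qj'' nδ) c := by
      simp only [map_add, map_smul, Pi.add_apply, Pi.smul_apply, smul_eq_mul]
    rw [expand] at hmono
    refine hmono.trans (add_le_add ?_ ?_)
    · exact mul_le_mul_of_nonneg_left (add_le_add e1 (mul_le_mul_of_nonneg_left e2 hε)) hl
    · exact mul_le_mul_of_nonneg_left e2 (by positivity)
  have hQ''r0 : 0 ≤ Q'' r c := apply_nonneg Q'' hop.monoQ'' r_nn c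
  -- assembling (153): T ≤ t₁ + t₂
  have ht1c : t₁ c ≤ Q g c + ε * Q'' g c := by
    simpa [Pi.add_apply, Pi.smul_apply, smul_eq_mul] using ht₁ c
  have ht2c : t₂ c ≤ C₁'' * K
      * (L⁻¹ * (W + ε * (2 * d * W)) + L⁻¹ * (C₃ * (L⁻¹ * a)) * (2 * d * W)) := by
    have h1 : t₂ c ≤ C₁'' * p * Q'' r c := by
      simpa [Pi.smul_apply, smul_eq_mul] using ht₂ c
    calc t₂ c ≤ C₁'' * p * Q'' r c := h1
      _ ≤ C₁'' * K * Q'' r c :=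
          mul_le_mul_of_nonneg_right (mul_le_mul_of_nonneg_left hK hC₁'') hQ''r0
      _ ≤ _ := mul_le_mul_of_nonneg_left hS4 (mul_nonneg hC₁'' hK0)
  calc T c ≤ t₁ c + t₂ c := hT c
    _ ≤ (C₃ * (L⁻¹ * a) * (κ * W) + ε * (C₃ * (L⁻¹ * a) * (2 * d * W)))
        + C₁'' * K * (L⁻¹ * (W + ε * (2 * d * W)) + L⁻¹ * (C₃ * (L⁻¹ * a)) * (2 * d * W)) :=
        add_le_add (ht1c.trans (add_le_add hS1 (mul_le_mul_of_nonneg_left hS2 hε))) ht2c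
    _ = _ := by rw [hK_def, hε_def, hW_def]; ring

/-- **(154), line 2 ⇒ line 3 ⇒ line 4** (p. 41), pure real arithmetic with `κ = 2 − L⁻¹`:
`(2 − L⁻¹)L⁻¹ ≤ 1 − L⁻²` (⟺ `L ≥ 2`), `(Lʲη)² ≤ L⁻²`, `Q_j|A| ≤ |A| ≤ α₁`, `C₂L⁻¹|A|² ≤ C₂L⁻¹α₁|A|`,
`(1 + u + v)(1 + u + w) ≤ (1 + u + v + w)²`, and `C₃ > 0` for the printed quotient `C″₁L⁻²/C₃`.
[cite: Balaban1985Averaging, (154) p.41] -/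
theorem ineq154_arith {L d C₁' C₁'' C₂ C₃ α₀ α₁ s a W : ℝ} (hL : 2 ≤ L) (hd : 0 ≤ d)
    (hC₁' : 0 ≤ C₁') (hC₁'' : 0 ≤ C₁'') (hC₂ : 0 ≤ C₂) (hC₃ : 0 < C₃) (hα₀ : 0 ≤ α₀) (hs : 0 ≤ s)
    (hsL : s ≤ L⁻¹ ^ 2) (ha : 0 ≤ a) (haα : a ≤ α₁) (hW : 0 ≤ W) :
    C₃ * (2 - L⁻¹) * L⁻¹ * a * W
        + C₁' * C₃ * 2 * α₀ * (2 * d) * s * L⁻¹ * a * W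
        + C₁'' * (L⁻¹ * (a + 2 * C₁' * α₀ * s * (2 * d) * a) + C₂ * (L⁻¹ * a) ^ 2)
            * (L⁻¹ * (1 + 2 * C₁' * α₀ * s * (2 * d) + C₃ * (L⁻¹ * a) * (2 * d)) * W)
      ≤ C₃ * a * W * (1 - L⁻¹ ^ 2 + 4 * d * C₁' * α₀ * L⁻¹ ^ 3
          + C₁'' * L⁻¹ ^ 2 / C₃
            * (1 + 4 * d * C₁' * α₀ * L⁻¹ ^ 2 + C₂ * L⁻¹ * α₁ + 2 * d * C₃ * L⁻¹ * α₁) ^ 2) := by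
  have hLpos : 0 < L := by linarith
  set l := L⁻¹ with hl_def
  have hl0 : 0 ≤ l := inv_nonneg.mpr hLpos.le
  have hl : l ≤ 1 / 2 := by
    rw [hl_def, inv_eq_one_div, div_le_div_iff₀ hLpos (by norm_num)]; linarith
  have hα₁ : 0 ≤ α₁ := ha.trans haα
  set u := 4 * d * C₁' * α₀ * l ^ 2 with hu_def
  set v := C₂ * l * α₁ with hv_def
  set w := 2 * d * C₃ * l * α₁ with hw_def
  have hu : 0 ≤ u := by rw [hu_def]; positivity
  have hv : 0 ≤ v := by rw [hv_def]; positivity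
  have hw : 0 ≤ w := by rw [hw_def]; positivity
  have hCaW : 0 ≤ C₃ * a * W := by positivity
  -- line 3, first summand
  have T1 : C₃ * (2 - l) * l * a * W ≤ C₃ * a * W * (1 - l ^ 2) := by
    have h1 : (2 - l) * l ≤ 1 - l ^ 2 := by nlinarith
    have := mul_le_mul_of_nonneg_left h1 hCaW
    linarith [this]
  have T2 : C₁' * C₃ * 2 * α₀ * (2 * d) * s * l * a * W ≤ C₃ * a * W * (4 * d * C₁' * α₀ * l ^ 3) := by
    have := mul_le_mul_of_nonneg_left hsL (by positivity : 0 ≤ C₁' * C₃ * 2 * α₀ * (2 * d) * l * a * W)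
    linarith [this]
  -- line 3, second summand
  have hεu : 2 * C₁' * α₀ * s * (2 * d) ≤ u := by
    have := mul_le_mul_of_nonneg_left hsL (by positivity : 0 ≤ 2 * C₁' * α₀ * (2 * d))
    rw [hu_def]; linarith [this]
  have hK : l * (a + 2 * C₁' * α₀ * s * (2 * d) * a) + C₂ * (l * a) ^ 2 ≤ l * a * (1 + u + v) := by
    have e : l * (a + 2 * C₁' * α₀ * s * (2 * d) * a) + C₂ * (l * a) ^ 2
        = l * a * (1 + 2 * C₁' * α₀ * s * (2 * d) + C₂ * l * a) := by ring
    rw [e]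
    have hva : C₂ * l * a ≤ v := by rw [hv_def]; exact mul_le_mul_of_nonneg_left haα (by positivity)
    exact mul_le_mul_of_nonneg_left (by linarith) (by positivity)
  have hR : l * (1 + 2 * C₁' * α₀ * s * (2 * d) + C₃ * (l * a) * (2 * d)) * W ≤ l * (1 + u + w) * W := by
    have hwa : C₃ * (l * a) * (2 * d) ≤ w := by
      have := mul_le_mul_of_nonneg_left haα (by positivity : 0 ≤ C₃ * l * (2 * d))
      rw [hw_def]; linarith [this]
    have : l * (1 + 2 * C₁' * α₀ * s * (2 * d) + C₃ * (l * a) * (2 * d)) ≤ l * (1 + u + w) :=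
      mul_le_mul_of_nonneg_left (by linarith) hl0
    exact mul_le_mul_of_nonneg_right this hW
  have T3 : C₁'' * (l * (a + 2 * C₁' * α₀ * s * (2 * d) * a) + C₂ * (l * a) ^ 2)
        * (l * (1 + 2 * C₁' * α₀ * s * (2 * d) + C₃ * (l * a) * (2 * d)) * W)
      ≤ C₁'' * (l * a * (1 + u + v)) * (l * (1 + u + w) * W) := by
    have h1 : C₁'' * (l * (a + 2 * C₁' * α₀ * s * (2 * d) * a) + C₂ * (l * a) ^ 2)
        ≤ C₁'' * (l * a * (1 + u + v)) := mul_le_mul_of_nonneg_left hK hC₁''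
    exact mul_le_mul h1 hR (by positivity) (by positivity)
  -- line 4: `(1 + u + v)(1 + u + w) ≤ (1 + u + v + w)²` and the quotient by `C₃`
  have T4 : C₁'' * (l * a * (1 + u + v)) * (l * (1 + u + w) * W)
      ≤ C₃ * a * W * (C₁'' * l ^ 2 / C₃ * (1 + u + v + w) ^ 2) := by
    have e : C₃ * a * W * (C₁'' * l ^ 2 / C₃ * (1 + u + v + w) ^ 2)
        = C₁'' * l ^ 2 * a * W * (1 + u + v + w) ^ 2 := by
      field_simp
    rw [e]
    have hsq : (1 + u + v) * (1 + u + w) ≤ (1 + u + v + w) ^ 2 := by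
      nlinarith [mul_nonneg hv (by positivity : 0 ≤ 1 + u + v), mul_nonneg hw (by positivity : 0 ≤ 1 + u + v)]
    have := mul_le_mul_of_nonneg_left hsq (by positivity : 0 ≤ C₁'' * l ^ 2 * a * W)
    calc C₁'' * (l * a * (1 + u + v)) * (l * (1 + u + w) * W)
        = C₁'' * l ^ 2 * a * W * ((1 + u + v) * (1 + u + w)) := by ring
      _ ≤ C₁'' * l ^ 2 * a * W * (1 + u + v + w) ^ 2 := this
  have total := add_le_add (add_le_add T1 T2) (T3.trans T4)
  calc _ ≤ C₃ * a * W * (1 - l ^ 2) + C₃ * a * W * (4 * d * C₁' * α₀ * l ^ 3)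
        + C₃ * a * W * (C₁'' * l ^ 2 / C₃ * (1 + u + v + w) ^ 2) := total
    _ = _ := by rw [hu_def, hv_def, hw_def]; ring

/-- **(154)** as printed (p. 41 [PDF 25]): under the hypotheses `Hyp154` and the operator facts with the
sharper constant `κ = 2 − L⁻¹` (see `OpFacts`), and `C₃ > 0` ("`C₃` is a positive constant", p. 40),
`|⟨(δ/δA)C_{j+1}(U₀,A), δA⟩| ≤ C₃|A|Q″_{j+1}|δA|·[1 − L⁻² + 4dC′₁α₀L⁻³ + (C″₁L⁻²/C₃)(1 + 4dC′₁α₀L⁻² +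
C₂L⁻¹α₁ + 2dC₃L⁻¹α₁)²]` pointwise on the level-`j+1` lattice. [cite: Balaban1985Averaging, (154) p.41] -/
theorem ineq154 {L d C₁' C₁'' C₂ C₃ α₀ α₁ s a p : ℝ} {nA nδ : B₀ → ℝ}
    {qA qδ g cj r : B₁ → ℝ} {t₁ t₂ T : B₂ → ℝ} {Qj Qj'' : (B₀ → ℝ) →ₗ[ℝ] (B₁ → ℝ)}
    {Q Q'' : (B₁ → ℝ) →ₗ[ℝ] (B₂ → ℝ)} {Qj1 Qj1'' : (B₀ → ℝ) →ₗ[ℝ] (B₂ → ℝ)}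
    (hop : OpFacts d (2 - L⁻¹) Qj Qj'' Q Q'' Qj1 Qj1'')
    (h : Hyp154 L d C₁' C₁'' C₂ C₃ α₀ α₁ s a p nA nδ qA qδ g cj r t₁ t₂ T Qj Qj'' Q Q'')
    (hC₃ : 0 < C₃) (c : B₂) :
    T c ≤ C₃ * a * Qj1'' nδ c * (1 - L⁻¹ ^ 2 + 4 * d * C₁' * α₀ * L⁻¹ ^ 3
          + C₁'' * L⁻¹ ^ 2 / C₃
            * (1 + 4 * d * C₁' * α₀ * L⁻¹ ^ 2 + C₂ * L⁻¹ * α₁ + 2 * d * C₃ * L⁻¹ * α₁) ^ 2) :=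
  (ineq154_line2 hop h c).trans
    (ineq154_arith h.hL h.hd h.hC₁' h.hC₁'' h.hC₂ hC₃ h.hα₀ h.hs h.hsL h.ha h.haα
      (apply_nonneg Qj1'' hop.monoQj1'' h.nδ_nonneg c))

/-- **(149)ⱼ₊₁ from (154) and (155)** (p. 41: *"This bound implies the inequality (149) for `j + 1` if*
(155)"): the bracket of (154) equals `1 + L⁻²·[4dC′₁α₀L⁻¹ + (C″₁/C₃)(…)² − 1] ≤ 1`, hence
`|⟨(δ/δA)C_{j+1}(U₀,A), δA⟩| ≤ C₃|A|Q″_{j+1}|δA|`. [cite: Balaban1985Averaging, (149), (154)–(155) pp.40–41] -/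
theorem ineq149_succ {L d C₁' C₁'' C₂ C₃ α₀ α₁ s a p : ℝ} {nA nδ : B₀ → ℝ}
    {qA qδ g cj r : B₁ → ℝ} {t₁ t₂ T : B₂ → ℝ} {Qj Qj'' : (B₀ → ℝ) →ₗ[ℝ] (B₁ → ℝ)}
    {Q Q'' : (B₁ → ℝ) →ₗ[ℝ] (B₂ → ℝ)} {Qj1 Qj1'' : (B₀ → ℝ) →ₗ[ℝ] (B₂ → ℝ)}
    (hop : OpFacts d (2 - L⁻¹) Qj Qj'' Q Q'' Qj1 Qj1'')
    (h : Hyp154 L d C₁' C₁'' C₂ C₃ α₀ α₁ s a p nA nδ qA qδ g cj r t₁ t₂ T Qj Qj'' Q Q'')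
    (hC₃ : 0 < C₃)
    (h155 : 4 * d * C₁' * α₀ * L⁻¹
        + C₁'' / C₃ * (1 + 4 * d * C₁' * α₀ * L⁻¹ ^ 2 + C₂ * L⁻¹ * α₁ + 2 * d * C₃ * L⁻¹ * α₁) ^ 2 ≤ 1) :
    T ≤ (C₃ * a) • Qj1'' nδ := by
  intro c
  have h154 := ineq154 hop h hC₃ c
  have hW : 0 ≤ Qj1'' nδ c := apply_nonneg Qj1'' hop.monoQj1'' h.nδ_nonneg c
  have hCaW : 0 ≤ C₃ * a * Qj1'' nδ c := by have := h.hC₃; have := h.ha; positivity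
  have hbr : 1 - L⁻¹ ^ 2 + 4 * d * C₁' * α₀ * L⁻¹ ^ 3
        + C₁'' * L⁻¹ ^ 2 / C₃
          * (1 + 4 * d * C₁' * α₀ * L⁻¹ ^ 2 + C₂ * L⁻¹ * α₁ + 2 * d * C₃ * L⁻¹ * α₁) ^ 2 ≤ 1 := by
    have e : 1 - L⁻¹ ^ 2 + 4 * d * C₁' * α₀ * L⁻¹ ^ 3
        + C₁'' * L⁻¹ ^ 2 / C₃
          * (1 + 4 * d * C₁' * α₀ * L⁻¹ ^ 2 + C₂ * L⁻¹ * α₁ + 2 * d * C₃ * L⁻¹ * α₁) ^ 2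
        = 1 + L⁻¹ ^ 2 * (4 * d * C₁' * α₀ * L⁻¹ + C₁'' / C₃
          * (1 + 4 * d * C₁' * α₀ * L⁻¹ ^ 2 + C₂ * L⁻¹ * α₁ + 2 * d * C₃ * L⁻¹ * α₁) ^ 2 - 1) := by
      ring
    rw [e]
    have hl2 : 0 ≤ L⁻¹ ^ 2 := by positivity
    nlinarith [mul_nonneg hl2 (by linarith [h155] : (0:ℝ) ≤ 1 - (4 * d * C₁' * α₀ * L⁻¹ + C₁'' / C₃
          * (1 + 4 * d * C₁' * α₀ * L⁻¹ ^ 2 + C₂ * L⁻¹ * α₁ + 2 * d * C₃ * L⁻¹ * α₁) ^ 2))]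
  have := mul_le_mul_of_nonneg_left hbr hCaW
  simp only [Pi.smul_apply, smul_eq_mul]
  linarith [h154, this]

/-- **(155) from the sample constants of p. 41** (*"we may take `C₃ = 6C″₁` and `α₀, α₁` satisfying
`4dC′₁α₀L⁻¹ ≤ ⅓`, `(C₂L⁻¹ + 12dC″₁L⁻¹)α₁ ≤ ⅔`"*), for `L ≥ 2`: the left side of (155) is then
`≤ ⅓ + (1/6)(1 + 1/6 + 2/3)² = 193/216` (the number of `B7.ineq155_sample`, census G-B7-03).
[cite: Balaban1985Averaging, (155) p.41] -/
theorem ineq155_of_sample {L d C₁' C₁'' C₂ C₃ α₀ α₁ : ℝ} (hL : 2 ≤ L) (hd : 0 ≤ d) (hC₁' : 0 ≤ C₁')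
    (hC₁'' : 0 < C₁'') (hC₂ : 0 ≤ C₂) (hα₀ : 0 ≤ α₀) (hα₁ : 0 ≤ α₁) (hC₃ : C₃ = 6 * C₁'')
    (h₀ : 4 * d * C₁' * α₀ * L⁻¹ ≤ 1 / 3) (h₁ : (C₂ * L⁻¹ + 12 * d * C₁'' * L⁻¹) * α₁ ≤ 2 / 3) :
    4 * d * C₁' * α₀ * L⁻¹
        + C₁'' / C₃ * (1 + 4 * d * C₁' * α₀ * L⁻¹ ^ 2 + C₂ * L⁻¹ * α₁ + 2 * d * C₃ * L⁻¹ * α₁) ^ 2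
      ≤ 1 := by
  have hLpos : 0 < L := by linarith
  have hl0 : 0 ≤ L⁻¹ := inv_nonneg.mpr hLpos.le
  have hl : L⁻¹ ≤ 1 / 2 := by
    rw [inv_eq_one_div, div_le_div_iff₀ hLpos (by norm_num)]; linarith
  have hq : C₁'' / C₃ = 1 / 6 := by
    rw [hC₃, div_eq_iff (by positivity)]; ring
  rw [hq]
  have hu : 4 * d * C₁' * α₀ * L⁻¹ ^ 2 ≤ 1 / 6 := by
    have e : 4 * d * C₁' * α₀ * L⁻¹ ^ 2 = (4 * d * C₁' * α₀ * L⁻¹) * L⁻¹ := by ring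
    rw [e]
    have := mul_le_mul h₀ hl hl0 (by norm_num)
    linarith
  have hvw : C₂ * L⁻¹ * α₁ + 2 * d * C₃ * L⁻¹ * α₁ ≤ 2 / 3 := by
    rw [hC₃]; nlinarith [h₁]
  have hX0 : 0 ≤ 1 + 4 * d * C₁' * α₀ * L⁻¹ ^ 2 + C₂ * L⁻¹ * α₁ + 2 * d * C₃ * L⁻¹ * α₁ := by
    rw [hC₃]; positivity
  have hX : 1 + 4 * d * C₁' * α₀ * L⁻¹ ^ 2 + C₂ * L⁻¹ * α₁ + 2 * d * C₃ * L⁻¹ * α₁ ≤ 11 / 6 := by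
    linarith
  have hX2 : (1 + 4 * d * C₁' * α₀ * L⁻¹ ^ 2 + C₂ * L⁻¹ * α₁ + 2 * d * C₃ * L⁻¹ * α₁) ^ 2
      ≤ (11 / 6) ^ 2 := pow_le_pow_left₀ hX0 hX 2
  nlinarith [hX2]

/-- Remark (`κ = 2` versus `κ = 2 − L⁻¹`).  With the constant `2` printed after (144), the first summand of
line 3 of (154) would be `C₃·2L⁻¹·|A|Q″_{j+1}|δA|`, and at `L = 2` the coefficient `2L⁻¹ = 1` leaves no
room for the remaining (positive) terms: the budget inequality `2·2⁻¹ + x ≤ 1` has no solution `x > 0`.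
The sharper `κ = 2 − L⁻¹` used in (154) is what admits `L = 2`; it is true (tent kernel, C-B7-D). [folklore] -/
theorem kappa_two_no_room {x : ℝ} (hx : 0 < x) : ¬ (2 * (2 : ℝ)⁻¹ + x ≤ 1) := by
  intro h
  norm_num at h
  linarith

/-! ## 4. Non-vacuity of the hypothesis structures -/

/-- `OpFacts` is satisfiable: one bond at each level, all six operators the identity, `d = 1`,
`κ = 3/2 = 2 − 2⁻¹`. [folklore] -/
theorem opFacts_nonvacuous :
    OpFacts (B₀ := Unit) (B₁ := Unit) (B₂ := Unit) 1 (2 - (2 : ℝ)⁻¹) LinearMap.id LinearMap.id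
      LinearMap.id LinearMap.id LinearMap.id LinearMap.id := by
  refine ⟨monotone_id, monotone_id, monotone_id, monotone_id, monotone_id, monotone_id,
    ?_, ?_, ?_, ?_, ?_, ?_⟩
  · intro f _; exact le_rfl
  · intro f hf c
    have := hf c
    simp only [LinearMap.id_coe, id_eq, Pi.smul_apply, smul_eq_mul, Pi.zero_apply] at this ⊢
    linarith
  · intro f _; exact le_rfl
  · intro f hf c
    have := hf c
    simp only [LinearMap.id_coe, id_eq, Pi.smul_apply, smul_eq_mul, Pi.zero_apply] at this ⊢
    linarith
  · intro f M _ hf c; simpa using hf c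
  · intro f M hM hf c
    have := hf c
    simp only [LinearMap.id_coe, id_eq]
    linarith

/-- `Hyp154` is satisfiable together with `opFacts_nonvacuous` (zero data, `L = 2`, `C₃ = 6`,
`C″₁ = 1`), and the sample constants of `ineq155_of_sample` hold there; so `ineq149_succ` is not an
implication from false premises. [folklore] -/
theorem hyp154_nonvacuous :
    Hyp154 (B₀ := Unit) (B₁ := Unit) (B₂ := Unit) 2 1 1 1 1 6 0 0 0 0 0 0 0 0 0 0 0 0 0 0 0
      LinearMap.id LinearMap.id LinearMap.id LinearMap.id := by
  refine ⟨by norm_num, by norm_num, by norm_num, by norm_num, by norm_num, by norm_num, le_rfl,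
    le_rfl, by norm_num, le_rfl, le_rfl, le_rfl, fun _ => le_rfl, le_rfl, le_rfl,
    ?_, ?_, ?_, ?_, ?_, ?_, ?_, ?_, ?_⟩
  all_goals (intro c; simp)

end Literature.MathematicalPhysics.QuantumFieldTheory.Balaban1983to89.B7Prop5Induction
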